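import Summits.MatrixMultiplication.MatrixMultiplication.Theorems.AbelianSTPPCensusFP2Defs

/-!
# Rule U11-F4 of the abelian STPP census: Pollard fibred over the Sylow subgroup at orders `M = 4p` (`FP4Adm`) and its kernel checker

Cell mm-stpp (rung F-M1), theory lane «past the quartet's walls» (seat mm-stpp-theory, gen 17).  A NEW necessary condition on the
shape list of an STPP family in a finite abelian group of order `M = 4p`, `p` an odd prime: `H` has a subgroup `P` of prime order `p`
and index `4` (four cosets, quotient `ℤ/4` or `ℤ/2 × ℤ/2`), Pollard's theorem holds INSIDE every pair of cosets of `P` with constant `1`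
at EVERY level and with NO structural branch — where the global rules lose: U11-G′ loses `⌊(4t² − 2t)/3⌋` (Grynkiewicz–Wang), U11-KP is
conditional on GW26 Conj. 2.2, FP2 (`AbelianSTPPCensusFP2Defs`) needs `M = 2p`, and GW2 (`AbelianSTPPCensusGW2Defs`) is silent at
`M ≡ 0 (mod 4)` because its structural branch with period `k/2` is size-feasible there (HOME/mm-stpp-theory/GW2-NOTE.md §4b).

THE RULE (form B; forms A, C are form B of the rotated families `(C,A,B)`, `(B,C,A)`).  Notation of `AbelianSTPPSieveVP` /
`AbelianSTPPCensusVPBookkeeping`: `X = ⋃ (B_j − A_j)` (`|X| = P_AB`), `Y = ⋃ (C_k − B_k)` (`|Y| = P_BC`), `Z′ = ⋃ (C_i − A_i)` (`|Z′| = P_CA`),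
`r_{X,Y}(c − a) = b_i` on `C_i − A_i`.  The four cosets of `P` are LABELLED `0, 1, 2, 3`, label `2i + j` standing for `(i, j) ∈ ℤ/2 × ℤ/2`,
with the addition table `addQ e` (`(i,j) + (i′,j′) = (i + i′, j + j′ + e·i·i′)`): `e = 1` is `ℤ/4` (generator `(1,0)`), `e = 0` is the Klein
four group.  `x, y, z : Q4` are the numbers of elements of `X, Y, Z′` in the four classes.  For the target class `c` (`W = z_c` elements of
`Z′`, `r`-values in `[vmin, cap] = [min b, max b]`) the four CLASS PAIRS `(X_g, Y_{c−g})`, `g = 0..3`, have all their sums in class `c`, and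
* (F1, Pollard per pair, FP2's `CosetIneq` with four pairs) for all levels `τ_g ≤ min(x_g, y_{c−g})`:
  `Σ_g τ_g·min(p, x_g + y_{c−g} − τ_g) ≤ W·min(T, cap) + T·(p − W)`, `T = Σ_g τ_g`;
* (F2, mass) `vmin·W ≤ Σ_g x_g·y_{c−g}`;  (F3, pointwise) `W ≥ 1 → vmin ≤ Σ_g min(x_g, y_{c−g})`;  (F4) `W ≤ p`.
`FP4Adm M a b c` says: IF `M = 4p` with `p` an odd prime THEN for one of the two tables some `(x, y, z)` passes all three letter forms
(`FormOK`).  Soundness (`IsSTPP ⇒ FP4Adm`) is `AbelianSTPPCensusFP4Sound.lean`; this file has the definitions and the Boolean checker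
`FP4.check`: a bisection of the 12-dimensional box of class counts with INTERVAL CONSTRAINT PROPAGATION at every node — sum tightening,
and per form and target an upper bound for the target count from (F2)/(F3) and from the violation test of (F1) read with the
per-target IDENTITY `Σ_g (x_g + y_{c−g}) = P_AB + P_BC` at a common level `t` on the pairs certified unsaturated (`FP4.violT`) plus each
remaining pair at its own level (`FP4.pc`); the new bound is found by a DOWNWARD LINEAR SCAN (`FP4.scanW`), so the checker's soundness
(`AbelianSTPPCensusFP4Check.lean`) needs no convexity.  Exact Python twin: seat folder `calc/fp4lean_twin.py` (604 = 4·151, list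
`(7,7,7)⁴ + (5,6,7)`: `check = true` for both tables, 3 451 / 3 435 nodes, menu `[6,11]`, 2 rounds, fuel 40).
WHAT THIS IS NOT: no claim here (definitions only); no `ω` statement; no census number; the rule is silent unless `M = 4p`.
-/

set_option linter.dupNamespace false -- `MatrixMultiplication.MatrixMultiplication` (summit = problem, D-0017)
set_option autoImplicit false

namespace Summit.MatrixMultiplication.MatrixMultiplication.Theorems

open Finset

namespace FP4

/-! ### Labels of the four cosets -/

/-- Addition table of the quotient of order `4` on labels `2i + j ↔ (i, j)`: `(i,j) + (i′,j′) = (i + i′, j + j′ + e·i·i′) (mod 2)`;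
`e = 1` is `ℤ/4`, `e = 0` is `ℤ/2 × ℤ/2` (checker vocabulary, no claim). [bookkeeping] -/
def addQ (e a b : ℕ) : ℕ := 2 * ((a / 2 + b / 2) % 2) + (a % 2 + b % 2 + e * ((a / 2) * (b / 2))) % 2

/-- Negation on labels: `−(i, j) = (i, j + e·i)`. [bookkeeping] -/
def negQ (e a : ℕ) : ℕ := 2 * (a / 2) + (a % 2 + e * (a / 2)) % 2

/-- Subtraction on labels: `c − a`, the label of the class pairing with class `a` into target class `c`. [bookkeeping] -/
def subQ (e c a : ℕ) : ℕ := addQ e c (negQ e a)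

/-- A vector of four natural numbers (class counts, or one end of a box of class counts). [bookkeeping] -/
structure Q4 where
  /-- entry of label `0 = (0,0)` -/
  v0 : ℕ
  /-- entry of label `1 = (0,1)` -/
  v1 : ℕ
  /-- entry of label `2 = (1,0)` -/
  v2 : ℕ
  /-- entry of label `3 = (1,1)` -/
  v3 : ℕ
deriving DecidableEq

namespace Q4

/-- Entry at a label (labels `≥ 3` read entry `3`). [bookkeeping] -/
def get (q : Q4) : ℕ → ℕ
  | 0 => q.v0
  | 1 => q.v1
  | 2 => q.v2
  | _ => q.v3

/-- Sum of the four entries. [bookkeeping] -/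
def sum (q : Q4) : ℕ := q.v0 + q.v1 + q.v2 + q.v3

/-- The vector read through negation of labels (`(neg e q).get g = q.get (−g)`): class counts of `−S` from those of `S`. [bookkeeping] -/
def neg (e : ℕ) (q : Q4) : Q4 := ⟨q.get (negQ e 0), q.get (negQ e 1), q.get (negQ e 2), q.get (negQ e 3)⟩

/-- Entrywise `≤` (Boolean). [bookkeeping] -/
def ble (q r : Q4) : Bool := decide (q.v0 ≤ r.v0) && decide (q.v1 ≤ r.v1) && decide (q.v2 ≤ r.v2) && decide (q.v3 ≤ r.v3)

/-- Replace the entry at label `i` (labels `≥ 3` write entry `3`). [bookkeeping] -/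
def set (q : Q4) (i val : ℕ) : Q4 :=
  match i with
  | 0 => {q with v0 := val}
  | 1 => {q with v1 := val}
  | 2 => {q with v2 := val}
  | _ => {q with v3 := val}

/-- Total width `Σ (hi − lo)` of the box `[lo, hi]`. [bookkeeping] -/
def width (lo hi : Q4) : ℕ := (hi.v0 - lo.v0) + (hi.v1 - lo.v1) + (hi.v2 - lo.v2) + (hi.v3 - lo.v3)

/-- The label of a widest coordinate of the box `[lo, hi]` (first one in case of ties). [bookkeeping] -/
def argWidest (lo hi : Q4) : ℕ :=
  let w0 := hi.v0 - lo.v0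
  let w1 := hi.v1 - lo.v1
  let w2 := hi.v2 - lo.v2
  let w3 := hi.v3 - lo.v3
  if w1 ≤ w0 ∧ w2 ≤ w0 ∧ w3 ≤ w0 then 0 else if w2 ≤ w1 ∧ w3 ≤ w1 then 1 else if w3 ≤ w2 then 2 else 3

end Q4

/-! ### Kernel evaluation-order devices (no mathematical content)

The kernel reduces lazily and does not share the value of a `let`/`match`-bound term between its occurrences; an expensive bound
(the result of a scan) that is read many times downstream would be recomputed at every read.  Matching a natural number against
`0 / m+1` forces it to a literal BEFORE the continuation is instantiated (`seqN n k = k n`, `FP4.seqN_eq`), which restores sharing. -/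

universe w in
/-- Force a natural number to a literal, then continue (`seqN n k = k n`; evaluation-order device). [bookkeeping] -/
def seqN {β : Sort w} (n : ℕ) (k : ℕ → β) : β :=
  match n with
  | 0 => k 0
  | m + 1 => k (m + 1)

universe w in
/-- Force the four entries of a `Q4`, then continue (`seqQ q k = k q`; evaluation-order device). [bookkeeping] -/
def seqQ {β : Sort w} (q : Q4) (k : Q4 → β) : β :=
  seqN q.v0 fun a => seqN q.v1 fun b => seqN q.v2 fun c => seqN q.v3 fun d => k ⟨a, b, c, d⟩

/-! ### The shape-level predicate -/

/-- One TARGET CLASS `c` of a letter form: summand class counts `u, v : Q4` (pairs `(u_g, v_{c−g})`, `g = 0..3`, table `e`), `W` target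
elements in class `c` with `r`-values in `[vmin, cap]`, cosets of size `p`: (F4) `W ≤ p`; (F1) the four Pollard floors (FP2's `pairFloor`) at
any admissible levels are jointly below the ceiling `W·min(T, cap) + T·(p − W)`; (F2) mass `vmin·W ≤ Σ u_g v_{c−g}`; (F3) pointwise
`W ≥ 1 → vmin ≤ Σ min(u_g, v_{c−g})` (shape-level predicate, no claim). [original] -/
def TargetOK (p e cap vmin : ℕ) (u v : Q4) (c W : ℕ) : Prop :=
  W ≤ p ∧
  (∀ τ0 τ1 τ2 τ3 : ℕ,
    τ0 ≤ u.get 0 → τ0 ≤ v.get (subQ e c 0) → τ1 ≤ u.get 1 → τ1 ≤ v.get (subQ e c 1) →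
    τ2 ≤ u.get 2 → τ2 ≤ v.get (subQ e c 2) → τ3 ≤ u.get 3 → τ3 ≤ v.get (subQ e c 3) →
      FP2.pairFloor p (u.get 0) (v.get (subQ e c 0)) τ0 + FP2.pairFloor p (u.get 1) (v.get (subQ e c 1)) τ1 +
        FP2.pairFloor p (u.get 2) (v.get (subQ e c 2)) τ2 + FP2.pairFloor p (u.get 3) (v.get (subQ e c 3)) τ3 ≤
      W * min (τ0 + τ1 + τ2 + τ3) cap + (τ0 + τ1 + τ2 + τ3) * (p - W)) ∧
  vmin * W ≤ u.get 0 * v.get (subQ e c 0) + u.get 1 * v.get (subQ e c 1) + u.get 2 * v.get (subQ e c 2) + u.get 3 * v.get (subQ e c 3) ∧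
  (1 ≤ W → vmin ≤ min (u.get 0) (v.get (subQ e c 0)) + min (u.get 1) (v.get (subQ e c 1)) +
    min (u.get 2) (v.get (subQ e c 2)) + min (u.get 3) (v.get (subQ e c 3)))

/-- One LETTER FORM `U + V → W′`: class counts `u, v, w` with totals `SU, SV, SW`, summand classes of size `≤ p`, and the four target
classes `TargetOK` (shape-level predicate, no claim). [original] -/
def FormOK (p e cap vmin SU SV SW : ℕ) (u v w : Q4) : Prop :=
  u.sum = SU ∧ v.sum = SV ∧ w.sum = SW ∧
  u.get 0 ≤ p ∧ u.get 1 ≤ p ∧ u.get 2 ≤ p ∧ u.get 3 ≤ p ∧ v.get 0 ≤ p ∧ v.get 1 ≤ p ∧ v.get 2 ≤ p ∧ v.get 3 ≤ p ∧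
  TargetOK p e cap vmin u v 0 (w.get 0) ∧ TargetOK p e cap vmin u v 1 (w.get 1) ∧
  TargetOK p e cap vmin u v 2 (w.get 2) ∧ TargetOK p e cap vmin u v 3 (w.get 3)

variable {N : ℕ}

/-- **Rule U11-F4 (Pollard fibred over the Sylow subgroup at `M = 4p`), shape form.**  At an order `M = 4p` with `p` an odd prime, for
every choice of lower bounds `va ≤ a_i`, `vb ≤ b_i`, `vc ≤ c_i` of the letter values, one of the two addition tables `e ∈ {0, 1}` of a
group of order `4` admits class counts `x, y, z : Q4` of `X = ⋃(B − A)`, `Y = ⋃(C − B)`, `Z′ = ⋃(C − A)` passing form B (`X, Y → Z′`, values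
`b`), form A (`−Z′, X → −Y`, values `a`; rotated family `(C, A, B)`; classes of `−S` = `Q4.neg e` of those of `S`) and form C
(`Y, −Z′ → −X`, values `c`; rotated family `(B, C, A)`).  Vacuous unless `M = 4p`.  The shape data of every `IsSTPP` family with
non-empty sets in a finite abelian group of order `M` satisfies it (`FP4.fp4Adm_of_isSTPP`, file `AbelianSTPPCensusFP4Sound`).
No claim by itself. [original] -/
def FP4Adm (M : ℕ) (a b c : Fin N → ℕ) : Prop :=
  ∀ p : ℕ, M = 4 * p → p.Prime → 3 ≤ p →
    ∀ va vb vc : ℕ, (∀ i, va ≤ a i) → (∀ i, vb ≤ b i) → (∀ i, vc ≤ c i) →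
      ∃ e : ℕ, e ≤ 1 ∧ ∃ x y z : Q4,
        FormOK p e (univ.sup b) vb (pAB a b c) (pBC a b c) (pCA a b c) x y z ∧
        FormOK p e (univ.sup a) va (pCA a b c) (pAB a b c) (pBC a b c) (z.neg e) x (y.neg e) ∧
        FormOK p e (univ.sup c) vc (pBC a b c) (pCA a b c) (pAB a b c) y (z.neg e) (x.neg e)

/-! ### The kernel checker (Boolean; soundness in `AbelianSTPPCensusFP4Check.lean`) -/

/-- Pollard's pair floor at level `t` net of the ceiling share `t·(p − W)`, in truncated arithmetic:
`t·(W ∸ ((p + t) ∸ (u + v)))` (checker-internal). [bookkeeping] -/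
def pv (p W u v t : ℕ) : ℕ := t * (W - ((p + t) - (u + v)))

/-- The level tried for a pair `(u, v)` against a target of `W` elements: `min(min(u,v), u + v − p)` if `u + v ≥ p + W`, else
`min(min(u,v), ⌊(u + v + W − p)/2⌋)` (the maximiser of `pv`; any level `≤ min(u,v)` would be sound; checker-internal). [bookkeeping] -/
def tOpt (p W u v : ℕ) : ℕ := min (min u v) (if p + W ≤ u + v then u + v - p else (u + v + W - p) / 2)

/-- The certified net contribution of one pair with class sizes AT LEAST `u, v`: `pv` at the level `tOpt` (checker-internal). [bookkeeping] -/
def pc (p W u v : ℕ) : ℕ := pv p W u v (tOpt p W u v)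

universe w in
/-- Force a Boolean, then continue (`seqB b k = k b`; evaluation-order device). [bookkeeping] -/
def seqB {β : Sort w} (b : Bool) (k : Bool → β) : β :=
  match b with
  | true => k true
  | false => k false

/-- The box of ONE class pair: lower/upper ends of the two summand classes. [bookkeeping] -/
structure Pr where
  /-- lower end of the first summand class -/
  ul : ℕ
  /-- upper end of the first summand class -/
  uh : ℕ
  /-- lower end of the second summand class -/
  vl : ℕ
  /-- upper end of the second summand class -/
  vh : ℕ
deriving DecidableEq

/-- The pair `g` of target `c`: classes `g` of the first summand and `c − g` of the second (checker-internal). [bookkeeping] -/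
def mkPr (e c g : ℕ) (ul uh vl vh : Q4) : Pr := ⟨ul.get g, uh.get g, vl.get (subQ e c g), vh.get (subQ e c g)⟩

universe w in
/-- Force the four entries of a `Pr`, then continue (`seqPr q k = k q`; evaluation-order device). [bookkeeping] -/
def seqPr {β : Sort w} (q : Pr) (k : Pr → β) : β :=
  seqN q.ul fun a => seqN q.uh fun b => seqN q.vl fun c => seqN q.vh fun d => k ⟨a, b, c, d⟩

/-- Is the pair certified UNSATURATED and of size `≥ t` on the whole box (`t ≤ ul`, `t ≤ vl`, `uh + vh ≤ p + t`)? (checker-internal) [bookkeeping] -/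
def good (p t : ℕ) (q : Pr) : Bool := decide (t ≤ q.ul) && decide (t ≤ q.vl) && decide (q.uh + q.vh ≤ p + t)

/-- Identity test, share of a CERTIFIED pair on the ceiling side: `t·(p − W) + t²` (else `0`; checker-internal). [bookkeeping] -/
def rT (p t W : ℕ) (g : Bool) : ℕ := if g then t * (p - W) + t * t else 0

/-- Identity test, share of a NON-certified pair on the ceiling side: `t·(uh + vh)` (else `0`; checker-internal). [bookkeeping] -/
def bT (t : ℕ) (g : Bool) (q : Pr) : ℕ := if g then 0 else t * (q.uh + q.vh)

/-- Identity test, share of a NON-certified pair on the floor side: `pc` at the lower corner (else `0`; checker-internal). [bookkeeping] -/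
def pT (p W : ℕ) (g : Bool) (q : Pr) : ℕ := if g then 0 else pc p W q.ul q.vl

/-- The IDENTITY test at level `t` for a target of `W` elements fed by the pairs `q0..q3`, `S = SU + SV = Σ_g (u_g + v_{c−g})`: every point of
the box violates (F1) if `cap·W + Σ_good (t(p − W) + t²) + Σ_bad t·(uh + vh) < t·S + Σ_bad pc` — the floor `t(u + v) − t²` of the certified
pairs summed with the identity `Σ_g (u_g + v_{c−g}) = S`, the other pairs at their own levels (checker-internal; soundness `FP4.violT_false`,
file `AbelianSTPPCensusFP4Check`). [bookkeeping] -/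
def violT (p cap S t W : ℕ) (q0 q1 q2 q3 : Pr) : Bool :=
  seqB (good p t q0) fun g0 => seqB (good p t q1) fun g1 => seqB (good p t q2) fun g2 => seqB (good p t q3) fun g3 =>
  decide (cap * W + rT p t W g0 + rT p t W g1 + rT p t W g2 + rT p t W g3 + bT t g0 q0 + bT t g1 q1 + bT t g2 q2 + bT t g3 q3 <
    t * S + pT p W g0 q0 + pT p W g1 q1 + pT p W g2 q2 + pT p W g3 q3)

/-- The all-pairs test: every point of the box with target count `W` violates (F1) if `cap·W < Σ_g pc` at the lower corners (checker-internal).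
[bookkeeping] -/
def viol0 (p cap W : ℕ) (q0 q1 q2 q3 : Pr) : Bool :=
  decide (cap * W < pc p W q0.ul q0.vl + pc p W q1.ul q1.vl + pc p W q2.ul q2.vl + pc p W q3.ul q3.vl)

/-- Is the target count `W` refuted for the whole box, by the all-pairs test or the identity test at some level of the menu? (checker-internal)
[bookkeeping] -/
def viol (p cap S : ℕ) (menu : List ℕ) (W : ℕ) (q0 q1 q2 q3 : Pr) : Bool :=
  viol0 p cap W q0 q1 q2 q3 || menu.any fun t => violT p cap S t W q0 q1 q2 q3

/-- DOWNWARD LINEAR SCAN: the largest `W′ ≤ h` that is not refuted (`0` if all of `1..h` are refuted; checker-internal). [bookkeeping] -/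
def scanW (p cap S : ℕ) (menu : List ℕ) (q0 q1 q2 q3 : Pr) : ℕ → ℕ
  | 0 => 0
  | h + 1 => if viol p cap S menu (h + 1) q0 q1 q2 q3 then scanW p cap S menu q0 q1 q2 q3 h else h + 1

/-- The mass at the upper corners, `Σ_g uh_g·vh_{c−g}` (checker-internal). [bookkeeping] -/
def massHi (q0 q1 q2 q3 : Pr) : ℕ := q0.uh * q0.vh + q1.uh * q1.vh + q2.uh * q2.vh + q3.uh * q3.vh

/-- The pointwise cap at the upper corners, `Σ_g min(uh_g, vh_{c−g})` (checker-internal). [bookkeeping] -/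
def ptHi (q0 q1 q2 q3 : Pr) : ℕ := min q0.uh q0.vh + min q1.uh q1.vh + min q2.uh q2.vh + min q3.uh q3.vh

/-- The starting upper bound of the scan: `0` if the pointwise cap is below `vmin`, else `min(wh, p, ⌊massHi/vmin⌋)` (`vmin = 0`: no mass
bound; checker-internal). [bookkeeping] -/
def startH (p vmin wh : ℕ) (q0 q1 q2 q3 : Pr) : ℕ :=
  if ptHi q0 q1 q2 q3 < vmin then 0 else min (min wh p) (if vmin = 0 then p else massHi q0 q1 q2 q3 / vmin)

/-- The new upper bound for the count of target class `c` (the four pair boxes are built and forced first; checker-internal). [bookkeeping] -/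
def newH (p e cap vmin S : ℕ) (menu : List ℕ) (c wh : ℕ) (ul uh vl vh : Q4) : ℕ :=
  seqPr (mkPr e c 0 ul uh vl vh) fun q0 => seqPr (mkPr e c 1 ul uh vl vh) fun q1 =>
  seqPr (mkPr e c 2 ul uh vl vh) fun q2 => seqPr (mkPr e c 3 ul uh vl vh) fun q3 =>
  scanW p cap S menu q0 q1 q2 q3 (startH p vmin wh q0 q1 q2 q3)

/-- One letter form on a box: the four new upper bounds of the target classes, or `none` if one of them falls below the lower bound
(checker-internal). [bookkeeping] -/
def narrowForm (p e cap vmin S : ℕ) (menu : List ℕ) (ul uh vl vh wl wh : Q4) : Option Q4 :=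
  seqN (newH p e cap vmin S menu 0 (wh.get 0) ul uh vl vh) fun h0 =>
  seqN (newH p e cap vmin S menu 1 (wh.get 1) ul uh vl vh) fun h1 =>
  seqN (newH p e cap vmin S menu 2 (wh.get 2) ul uh vl vh) fun h2 =>
  seqN (newH p e cap vmin S menu 3 (wh.get 3) ul uh vl vh) fun h3 =>
  if h0 < wl.get 0 ∨ h1 < wl.get 1 ∨ h2 < wl.get 2 ∨ h3 < wl.get 3 then none else some ⟨h0, h1, h2, h3⟩

/-- Sum tightening of the lower ends: `lo_i := max(lo_i, T ∸ Σ_{j ≠ i} hi_j)` (checker-internal). [bookkeeping] -/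
def tightLo (T : ℕ) (lo hi : Q4) : Q4 :=
  ⟨max lo.v0 (T - (hi.v1 + hi.v2 + hi.v3)), max lo.v1 (T - (hi.v0 + hi.v2 + hi.v3)),
    max lo.v2 (T - (hi.v0 + hi.v1 + hi.v3)), max lo.v3 (T - (hi.v0 + hi.v1 + hi.v2))⟩

/-- Sum tightening of the upper ends: `hi_i := min(hi_i, T ∸ Σ_{j ≠ i} lo_j)` (checker-internal). [bookkeeping] -/
def tightHi (T : ℕ) (lo hi : Q4) : Q4 :=
  ⟨min hi.v0 (T - (lo.v1 + lo.v2 + lo.v3)), min hi.v1 (T - (lo.v0 + lo.v2 + lo.v3)),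
    min hi.v2 (T - (lo.v0 + lo.v1 + lo.v3)), min hi.v3 (T - (lo.v0 + lo.v1 + lo.v2))⟩

/-- Can the box `[lo, hi]` contain a vector of total `T`? (`lo ≤ hi` entrywise, `Σ lo ≤ T ≤ Σ hi`; checker-internal) [bookkeeping] -/
def okVec (T : ℕ) (lo hi : Q4) : Bool := lo.ble hi && decide (lo.sum ≤ T) && decide (T ≤ hi.sum)

/-- A box of class counts: lower and upper ends for `x` (classes of `X`), `y`, `z` (classes of `Z′`). [bookkeeping] -/
structure Box where
  /-- lower ends of the classes of `X` -/
  xl : Q4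
  /-- upper ends of the classes of `X` -/
  xh : Q4
  /-- lower ends of the classes of `Y` -/
  yl : Q4
  /-- upper ends of the classes of `Y` -/
  yh : Q4
  /-- lower ends of the classes of `Z′` -/
  zl : Q4
  /-- upper ends of the classes of `Z′` -/
  zh : Q4
deriving DecidableEq

universe w in
/-- Force the twenty-four entries of a `Box`, then continue (`seqBox b k = k b`; evaluation-order device). [bookkeeping] -/
def seqBox {β : Sort w} (b : Box) (k : Box → β) : β :=
  seqQ b.xl fun xl => seqQ b.xh fun xh => seqQ b.yl fun yl => seqQ b.yh fun yh => seqQ b.zl fun zl => seqQ b.zh fun zh =>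
    k ⟨xl, xh, yl, yh, zl, zh⟩

/-- ONE ROUND OF PROPAGATION on a box (`none` = the box contains no admissible split): sum tightening of the three vectors, then form B
(`x, y → z`, values `b`: `cb = max b`, `mb ≤ min b`), form A (`−z, x → −y`, values `a`), form C (`y, −z → −x`, values `c`), each reading the
bounds already tightened by the previous one (checker-internal). [bookkeeping] -/
def narrow (p e X Y Z ca cb cc ma mb mc : ℕ) (menu : List ℕ) (b : Box) : Option Box :=
  seqBox ⟨tightLo X b.xl b.xh, tightHi X b.xl b.xh, tightLo Y b.yl b.yh, tightHi Y b.yl b.yh, tightLo Z b.zl b.zh, tightHi Z b.zl b.zh⟩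
    fun t =>
  if !(okVec X t.xl t.xh && okVec Y t.yl t.yh && okVec Z t.zl t.zh) then none
  else
    match narrowForm p e cb mb (X + Y) menu t.xl t.xh t.yl t.yh t.zl t.zh with
    | none => none
    | some zh1 =>
      match narrowForm p e ca ma (Z + X) menu (t.zl.neg e) (zh1.neg e) t.xl t.xh (t.yl.neg e) (t.yh.neg e) with
      | none => none
      | some yhn =>
        seqQ (yhn.neg e) fun yh1 =>
        match narrowForm p e cc mc (Y + Z) menu t.yl yh1 (t.zl.neg e) (zh1.neg e) (t.xl.neg e) (t.xh.neg e) with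
        | none => none
        | some xhn =>
          seqQ (xhn.neg e) fun xh1 =>
          if okVec X t.xl xh1 && okVec Y t.yl yh1 && okVec Z t.zl zh1 then some ⟨t.xl, xh1, t.yl, yh1, t.zl, zh1⟩
          else none

/-- `R` rounds of propagation (checker-internal). [bookkeeping] -/
def narrowR (p e X Y Z ca cb cc ma mb mc : ℕ) (menu : List ℕ) : ℕ → Box → Option Box
  | 0, b => some b
  | r + 1, b =>
    match narrow p e X Y Z ca cb cc ma mb mc menu b with
    | none => none
    | some b' => narrowR p e X Y Z ca cb cc ma mb mc menu r b'

/-- BISECTION of a box along a widest coordinate of the widest of the three vectors: the two halves (checker-internal). [bookkeeping] -/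
def split (b : Box) : Box × Box :=
  let wx := Q4.width b.xl b.xh
  let wy := Q4.width b.yl b.yh
  let wz := Q4.width b.zl b.zh
  if wy ≤ wx ∧ wz ≤ wx then
    let i := Q4.argWidest b.xl b.xh
    let mid := (b.xl.get i + b.xh.get i) / 2
    ({ b with xh := b.xh.set i mid }, { b with xl := b.xl.set i (mid + 1) })
  else if wz ≤ wy then
    let i := Q4.argWidest b.yl b.yh
    let mid := (b.yl.get i + b.yh.get i) / 2
    ({ b with yh := b.yh.set i mid }, { b with yl := b.yl.set i (mid + 1) })
  else
    let i := Q4.argWidest b.zl b.zh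
    let mid := (b.zl.get i + b.zh.get i) / 2
    ({ b with zh := b.zh.set i mid }, { b with zl := b.zl.set i (mid + 1) })

/-- Is the box degenerate (all twelve widths zero)? (then bisection cannot proceed; checker-internal) [bookkeeping] -/
def isPoint (b : Box) : Bool :=
  decide (Q4.width b.xl b.xh = 0 ∧ Q4.width b.yl b.yh = 0 ∧ Q4.width b.zl b.zh = 0)

/-- BOX CERTIFICATION with fuel: `R` rounds of propagation; a surviving box is bisected and both halves are certified with one unit of
fuel less (checker-internal; soundness `FP4.certify_sound`). [bookkeeping] -/
def certify (p e X Y Z ca cb cc ma mb mc : ℕ) (menu : List ℕ) (R : ℕ) : ℕ → Box → Bool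
  | 0, b => (narrowR p e X Y Z ca cb cc ma mb mc menu R b).isNone
  | fuel + 1, b =>
    match narrowR p e X Y Z ca cb cc ma mb mc menu R b with
    | none => true
    | some b' =>
      !isPoint b' &&
        (seqBox (split b').1 fun b1 => seqBox (split b').2 fun b2 =>
          certify p e X Y Z ca cb cc ma mb mc menu R fuel b1 && certify p e X Y Z ca cb cc ma mb mc menu R fuel b2)

/-- The root box: every class count in `[0, min(total, p)]`. [bookkeeping] -/
def rootBox (p X Y Z : ℕ) : Box :=
  ⟨⟨0, 0, 0, 0⟩, ⟨min X p, min X p, min X p, min X p⟩, ⟨0, 0, 0, 0⟩, ⟨min Y p, min Y p, min Y p, min Y p⟩,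
    ⟨0, 0, 0, 0⟩, ⟨min Z p, min Z p, min Z p, min Z p⟩⟩

/-- **The checker for one table `e`.**  `check e p X Y Z ca cb cc ma mb mc menu R fuel = true` means: every split `(x, y, z)` of
`(P_AB, P_BC, P_CA) = (X, Y, Z)` into four classes of size `≤ p` is refuted for the table `e`, letter maxima `(ca, cb, cc)` and letter
lower bounds `(ma, mb, mc)` (`FP4.certify_sound`, file `AbelianSTPPCensusFP4Check`). [bookkeeping] -/
def check (e p X Y Z ca cb cc ma mb mc : ℕ) (menu : List ℕ) (R fuel : ℕ) : Bool :=
  certify p e X Y Z ca cb cc ma mb mc menu R fuel (rootBox p X Y Z)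

/-- **The checker for both tables** (`ℤ/4` and `ℤ/2 × ℤ/2`): `true` refutes `FP4Adm (4p)` for every shape list with these totals, maxima and
minima (`FP4.not_fp4Adm_of_checkBoth`, file `AbelianSTPPCensusFP4Check`). [bookkeeping] -/
def checkBoth (p X Y Z ca cb cc ma mb mc : ℕ) (menu : List ℕ) (R fuel : ℕ) : Bool :=
  check 0 p X Y Z ca cb cc ma mb mc menu R fuel && check 1 p X Y Z ca cb cc ma mb mc menu R fuel

/-! ### Sanity (kernel evaluation on toy data) -/

/-- In `ℤ/4` (`e = 1`) the label `2 = (1,0)` has order `4`: `2 + 2 = 1`, `1 + 2 = 3`, `3 + 2 = 0`. [bookkeeping] -/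
example : addQ 1 2 2 = 1 ∧ addQ 1 1 2 = 3 ∧ addQ 1 3 2 = 0 := by decide

/-- In the Klein four group (`e = 0`) every label is its own negative; in `ℤ/4` negation swaps `2` and `3`. [bookkeeping] -/
example : (negQ 0 0, negQ 0 1, negQ 0 2, negQ 0 3) = (0, 1, 2, 3) ∧ (negQ 1 0, negQ 1 1, negQ 1 2, negQ 1 3) = (0, 1, 3, 2) := by decide

/-- A full coset facing a class of `8 > cap = 7` elements refutes every positive target count (`pc = W·8 > 7·W`): the class pair
`(151, 8)` at `p = 151`. [bookkeeping] -/
example : pc 151 60 151 8 = 480 ∧ viol0 151 7 60 ⟨151, 151, 8, 8⟩ ⟨0, 0, 0, 0⟩ ⟨0, 0, 0, 0⟩ ⟨0, 0, 0, 0⟩ = true := by decide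

/-- One propagation round on the root box of the `604` list `(7,7,7)⁴ + (5,6,7)` (table `ℤ/4`) does not yet refute it. [bookkeeping] -/
example : (narrow 151 1 226 238 231 7 7 7 5 6 7 [3, 6, 9, 12, 15] (rootBox 151 226 238 231)).isSome = true := by decide

end FP4

end Summit.MatrixMultiplication.MatrixMultiplication.Theorems
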